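import Mathlib
import Summits.ValiantsHypothesis.ValiantsHypothesis.Theorems.ValuativeGCTValuativeFlipOuterSeparation
import Literature.Computability.AlgebraicComplexity.BorderDcQuadraticBoundProofs
import Literature.NumberTheory.DiophantineGeometry.SchurWeylPlethysmRenameProofs
import Literature.Computability.Complexity.OccurrenceObstructionsBIP
import Summits.ValiantsHypothesis.ValiantsHypothesis.Theorems.ValuativeGCTValuativeFlipNoSmallBodyEquations
import Summits.ValiantsHypothesis.ValiantsHypothesis.Theorems.ValuativeGCTValuativeFlipDetEqFreeTwoLetters
import Summits.ValiantsHypothesis.ValiantsHypothesis.Theorems.ValuativeGCTNoValuativeFlipOutsideKL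
import Summits.ValiantsHypothesis.ValiantsHypothesis.Theorems.ValuativeGCTValuativeBound
import HarnessLib

/-!
# Outer padded-permanent highest-weight vectors in the LOW TAIL `n < m ≤ (n² - 1)/2`
# (crux `ValuativeGCT.ValuativeFlip`, stmt-ValiantsHypothesis-12624; wall-breaker k13 gen 1 seat 2,
# axis "explicit padded-permanent highest-weight vectors"; helper file `--supports`)

Sibling of `Theorems/ValuativeGCTValuativeFlipOuterSeparation.lean` (the structure theorem:
`g ∉ Δ_m(f)` iff some highest-weight EQUATION of `Δ_m(f)` is non-zero on `GL · g`).  Here the instance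
the crux cares about: `f = det_m`, `g = X₀₀^{m-n} per_n` in the lexicographic matrix variables
(`detFormLex`, `paddedPerFormLex`), at the positions `n ≤ m`, `2m + 1 ≤ n²` where non-membership is a
THEOREM of the tree (Landsberg–Manivel–Ressayre 2013 Thm 1.1.1, `LMR2013_thm_1_1_1_holds`, via
Hessian rank; transported by `hasBorderDetRepr_iff_rename_holds`).  This range contains the whole
head `n ≤ m ≤ 1.2·n` of the window (closed, `HeadFlip`), the counting barrier `√2·n`, and reaches
`≈ n²/2` — the only part of the tail where ANY separating object is known in print.

* `lto_paddedPerFormLex_not_mem_orbitClosure` — `X₀₀^{m-n} per_n ∉ Δ_m(det_m)` for `2m + 1 ≤ n²`;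
* `lto_mem_orbitClosure_det_iff_forall_hwv`, `lto_hasBorderDetRepr_iff_forall_hwv` — border
  determinantal representations in HWV form: `X₀₀^{m-n} per_n ∈ Δ_m(det_m)` iff every highest-weight
  EQUATION of `Δ_m(det_m)` vanishes on `GL · pp` (so `\underline{dc}(per_n) > m` iff an outer HWV exists at `(n, m)`);
* `lto_exists_outer_hwv` — hence an OUTER highest-weight vector exists there: some `B`-semi-invariant
  `F ∈ ℂ[Sym^m ℂ^{m×m}]` is an equation of `Δ_m(det_m)` and non-zero on `GL · pp` (PE4 of the crux's
  `DECOMPOSITIONS.md`, existential form; in print the module is LMR's `Ω(2m-2, m)` in degree `2m(m-1)`);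
* `lto_exists_partition` — the same in the crux's partition currency `λ* = (dualOfPartition (m·m) λ).toMatIdx`,
  with everything the landed no-go theorems force on the weight: `λ₁ ≥ δ(m-n)` (Kadish–Landsberg), body
  `> m` (`noSmallBodyEquations`), `≥ 3` rows (two-letter equation-freeness), `≤ n² + 1` rows; at `λ*`
  the padded permanent OCCURS (`1 ≤ mult`) and the determinant has an EQUATION (`K_m(λ*) + 1 ≤ a_λ(δ[m])`),
  so PER-SIDE FULLNESS at `λ*` (an explicit-evaluation statement about `pp` alone) would already be a
  multiplicity obstruction `K_m(λ*) < mult_{λ*} ℂ[Δ_m(pp)]` above the head;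
* `lto_exists_outer_hwv_of_flipAt` — conversely every witness of the crux (the body of
  `ValuativeGCT.ValuativeFlip` verbatim at `(n, m, U, r, δ, λ)`) contains an outer highest-weight vector
  OF WEIGHT `λ*` (by the proved `ValuativeBound`, `K_m(λ*) ≤ dim T_U(λ) < mult`).

Sources: J. M. Landsberg, L. Manivel, N. Ressayre, Comment. Math. Helv. 88 (2013) 469–484, Thm 1.1.1,
Thm 2.3.1, Lemma 2.4.1, §3.2; BLMW, SIAM J. Comput. 40 (2011) §4.4–§5; Kadish–Landsberg, Comm. Algebra
42 (2014); Bürgisser–Ikenmeyer–Panova, J. AMS 32 (2019) §4; this crux's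
`Cruxes/ValuativeFlip/DECOMPOSITIONS.md` §1 (PE4) and `Cruxes/TailFlip/Lines/Sketch-dead.md`.
-/

set_option linter.dupNamespace false

namespace Summit.ValiantsHypothesis.ValiantsHypothesis.Theorems.ValuativeFlip

open MvPolynomial
open scoped BigOperators Matrix
open Literature.NumberTheory.DiophantineGeometry
open Literature.Computability.AlgebraicComplexity

noncomputable section

/-! ## The padded permanent versus the determinant in the LOW TAIL `n ≤ m ≤ (n² - 1)/2` -/

section LowTail

open Literature.Computability.Complexity

/-- **Non-membership in the low tail** (Landsberg–Manivel–Ressayre 2013, Thm 1.1.1, PROVED in the tree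
as `LMR2013_thm_1_1_1_holds`, transported to the lexicographic matrix variables by
`hasBorderDetRepr_iff_rename_holds`): for `n ≤ m` and `2m + 1 ≤ n²` the padded permanent
`X₀₀^{m-n} per_n` is not in `Δ_m(det_m)`. [cite: LandsbergManivelRessayre2013, Theorem 1.1.1] -/
theorem lto_paddedPerFormLex_not_mem_orbitClosure {n m : ℕ} [NeZero m] (hnm : n ≤ m)
    (h : 2 * m + 1 ≤ n ^ 2) : paddedPerFormLex ℂ n m ∉ orbitClosure (detFormLex ℂ m) := by
  intro hmem
  have h1 : HasBorderDetRepr ℂ n m := (hasBorderDetRepr_iff_rename_holds (k := ℂ) n m).mpr hmem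
  have h2 : n ^ 2 ≤ 2 * m := LMR2013_thm_1_1_1_holds n m hnm h1
  omega


/-- **Border determinantal representations, in highest-weight-vector form.**  For `n ≤ m`:
`X₀₀^{m-n} per_n ∈ Δ_m(det_m)` (the padded permanent has a border determinantal representation of size
`m`, `HasBorderDetRepr ℂ n m` up to `hasBorderDetRepr_iff_rename_holds`) iff EVERY highest-weight
equation of `Δ_m(det_m)` — every `B`-semi-invariant `F ∈ HWV_χ(ℂ[Sym^m]) ∩ I(GL · det_m)`, any weight
`χ` — vanishes on `GL · X₀₀^{m-n} per_n`.  Equivalently: `\underline{dc}(per_n) > m` iff an outer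
highest-weight vector exists at `(n, m)` (`os_exists_hwv_sep_of_not_mem_orbitClosure`,
`os_not_mem_orbitClosure_of_sep`).  BLMW 2011 §1, §4.4; Mulmuley–Sohoni 2001 §4. [folklore] -/
theorem lto_mem_orbitClosure_det_iff_forall_hwv {n m : ℕ} [NeZero m] (hnm : n ≤ m) :
    paddedPerFormLex ℂ n m ∈ orbitClosure (detFormLex ℂ m) ↔
      ∀ (χ : Weight (MatIdx m)) (F : MvPolynomial (DegIdx (MatIdx m) m) ℂ),
        F ∈ highestWeightSpace (coordRep (MatIdx m) ℂ m) χ →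
          F ∈ orbitVanishingIdeal (detFormLex ℂ m) m → F ∈ orbitVanishingIdeal (paddedPerFormLex ℂ n m) m := by
  constructor
  · intro hmem χ F _ hFdet
    by_contra hFpp
    exact os_not_mem_orbitClosure_of_sep (detFormLex_isHomogeneous ℂ m) (detFormLex_ne_zero m)
      hFdet hFpp hmem
  · intro hall
    by_contra hnot
    obtain ⟨χ, F, hF, hFdet, hFpp⟩ := os_exists_hwv_sep_of_not_mem_orbitClosure
      (detFormLex_isHomogeneous ℂ m) (detFormLex_ne_zero m) (paddedPerFormLex_isHomogeneous ℂ hnm) hnot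
    exact hFpp (hall χ F hF hFdet)

/-- The same for G20's `HasBorderDetRepr ℂ n m` (`X₀₀^{m-n} per_n ∈ Δ[det_m]` in the variables
`Fin m × Fin m`): a border determinantal representation of size `m` exists iff no outer highest-weight
vector exists at `(n, m)`.  [folklore] -/
theorem lto_hasBorderDetRepr_iff_forall_hwv {n m : ℕ} [NeZero m] (hnm : n ≤ m) :
    HasBorderDetRepr ℂ n m ↔
      ∀ (χ : Weight (MatIdx m)) (F : MvPolynomial (DegIdx (MatIdx m) m) ℂ),
        F ∈ highestWeightSpace (coordRep (MatIdx m) ℂ m) χ →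
          F ∈ orbitVanishingIdeal (detFormLex ℂ m) m → F ∈ orbitVanishingIdeal (paddedPerFormLex ℂ n m) m :=
  (hasBorderDetRepr_iff_rename_holds (k := ℂ) n m).trans (lto_mem_orbitClosure_det_iff_forall_hwv hnm)

/-- **Outer padded-permanent highest-weight vectors exist throughout the low tail.**  For `n ≤ m`,
`2m + 1 ≤ n²`, some highest-weight vector `F ∈ ℂ[Sym^m ℂ^{m×m}]` (of some weight `χ` of `GL_{m²}`) is an
EQUATION of `Δ_m(det_m)` and does NOT vanish on `GL_{m²} · X₀₀^{m-n} per_n` (its class is a non-zero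
highest-weight vector of `ℂ[Δ_m(X₀₀^{m-n} per_n)]`): `os_exists_hwv_sep_of_not_mem_orbitClosure` on the
Landsberg–Manivel–Ressayre non-membership.  (In print the explicit module is LMR's `Ω(2m-2, m)` in
degree `2m(m-1)`, Thm 2.3.1/3.1.1; here the weight is not pinned.)
[cite: LandsbergManivelRessayre2013, Theorem 1.1.1] -/
theorem lto_exists_outer_hwv {n m : ℕ} [NeZero m] (hnm : n ≤ m) (h : 2 * m + 1 ≤ n ^ 2) :
    ∃ (χ : Weight (MatIdx m)) (F : MvPolynomial (DegIdx (MatIdx m) m) ℂ),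
      F ∈ highestWeightSpace (coordRep (MatIdx m) ℂ m) χ ∧
      F ∈ orbitVanishingIdeal (detFormLex ℂ m) m ∧ F ∉ orbitVanishingIdeal (paddedPerFormLex ℂ n m) m :=
  os_exists_hwv_sep_of_not_mem_orbitClosure (detFormLex_isHomogeneous ℂ m) (detFormLex_ne_zero m)
    (paddedPerFormLex_isHomogeneous ℂ hnm) (lto_paddedPerFormLex_not_mem_orbitClosure hnm h)

/-- **The low-tail separating weight, in the crux's partition currency, with its constraints.**
For `n ≤ m`, `2m + 1 ≤ n²` there are `δ` and `λ ⊢ m·δ` with at most `min(m², n²+1)` parts such that, at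
the weight `λ* = (dualOfPartition (m·m) λ).toMatIdx` of the route:
* the padded permanent OCCURS: `1 ≤ mult_{λ*} ℂ[Δ_m(X₀₀^{m-n} per_n)]`;
* the determinant has an EQUATION: `K_m(λ*) + 1 ≤ plethysmCoeff λ*` (`= a_λ(δ[m])`);
* hence (landed no-go theorems read backwards) `λ₁ ≥ δ(m-n)` (Kadish–Landsberg), the body exceeds
  `m` (`noSmallBodyEquations`: `Det_m` is equation-free at body `≤ m`) and `λ` has at least three rows
  (`orbitMultiplicity_det_eq_plethysmCoeffOfPartition_of_card_parts_le_two`: equation-free on two letters);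
* and a PER-SIDE FULLNESS certificate at `λ*` — `mult_{λ*} ℂ[Δ_m(pp)] = a_λ(δ[m])`, i.e. no
  highest-weight vector of weight `λ*` vanishes on `GL · pp`, an explicit-evaluation statement about
  the padded permanent alone — would already be a multiplicity obstruction `K_m(λ*) < mult_{λ*} ℂ[Δ_m(pp)]`
  ABOVE the head of the window (`os_lt_of_full_of_equation`).
[cite: LandsbergManivelRessayre2013, Theorem 1.1.1] -/
theorem lto_exists_partition {n m : ℕ} [NeZero m] (hnm : n ≤ m) (h : 2 * m + 1 ≤ n ^ 2) :
    ∃ (δ : ℕ) (lam : Nat.Partition (m * δ)),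
      lam.parts.card ≤ m * m ∧ lam.parts.card ≤ n ^ 2 + 1 ∧ δ * (m - n) ≤ lam.parts.sup ∧
      m < bodySize lam ∧ 3 ≤ lam.parts.card ∧
      1 ≤ orbitMultiplicity ℂ (paddedPerFormLex ℂ n m) m (partitionWeightLex m lam) ∧
      orbitMultiplicity ℂ (detFormLex ℂ m) m (partitionWeightLex m lam) + 1 ≤
        plethysmCoeff ℂ (MatIdx m) m (partitionWeightLex m lam) ∧
      (orbitMultiplicity ℂ (paddedPerFormLex ℂ n m) m (partitionWeightLex m lam) =
          plethysmCoeff ℂ (MatIdx m) m (partitionWeightLex m lam) →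
        orbitMultiplicity ℂ (detFormLex ℂ m) m (partitionWeightLex m lam) <
          orbitMultiplicity ℂ (paddedPerFormLex ℂ n m) m (partitionWeightLex m lam)) := by
  classical
  have hm : m ≠ 0 := NeZero.ne m
  obtain ⟨χ, F, hF, hFdet, hFpp⟩ := lto_exists_outer_hwv hnm h
  obtain ⟨hocc1, heq⟩ := os_occurs_and_equation hm (detFormLex ℂ m) (paddedPerFormLex ℂ n m) hF hFdet hFpp
  -- the weight occurs in `ℂ[Δ_m(pp)]`, hence is the dual weight of a partition
  have hocc : HasHighestWeight (paddedPerOrbitRep ℂ n m) χ := by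
    intro hbot
    have h0 : orbitMultiplicity ℂ (paddedPerFormLex ℂ n m) m χ = 0 := by
      rw [orbitMultiplicity, hwMultiplicity]
      change Module.finrank ℂ ↥(highestWeightSpace (paddedPerOrbitRep ℂ n m) χ) = 0
      rw [hbot]
      exact finrank_bot ℂ _
    omega
  obtain ⟨d, lam, hcardn, hcardm, hχ⟩ :=
    exists_partition_of_hasHighestWeight_paddedPerOrbitRep_holds n m hnm χ hocc
  subst hχ
  -- re-type `λ ⊢ d·m` as a partition of `m·d` (same parts, same weight)
  let lam' : Nat.Partition (m * d) := ⟨lam.parts, lam.parts_pos, by rw [lam.parts_sum, Nat.mul_comm]⟩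
  have hcardm' : lam'.parts.card ≤ m * m := hcardm
  have hcardn' : lam'.parts.card ≤ n ^ 2 + 1 := hcardn
  have hocc' : HasHighestWeight (paddedPerOrbitRep ℂ n m) (Weight.dualOfPartition (m * m) lam').toMatIdx := hocc
  have hocc1' : 1 ≤ orbitMultiplicity ℂ (paddedPerFormLex ℂ n m) m (partitionWeightLex m lam') := hocc1
  have heq' : orbitMultiplicity ℂ (detFormLex ℂ m) m (partitionWeightLex m lam') + 1 ≤
      plethysmCoeff ℂ (MatIdx m) m (partitionWeightLex m lam') := heq
  -- Kadish–Landsberg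
  have hKL : d * (m - n) ≤ lam'.parts.sup :=
    (NoValuativeFlip.kadishLandsberg_of_hasHighestWeight_paddedPerOrbitRep hnm lam' hcardm' hocc').1
  -- body `> m`: `Det_m` is equation-free at body `≤ m`
  have hbody : m < bodySize lam' := by
    by_contra hle
    have hle' : bodySize lam' ≤ m := not_lt.mp hle
    have hfree := noSmallBodyEquations m d lam' hcardm' hle'
    omega
  -- at least three rows: `Det_m` is equation-free on two letters
  have hrows : 3 ≤ lam'.parts.card := by
    by_contra hlt
    have h2 : lam'.parts.card ≤ 2 := by omega
    have hfree := orbitMultiplicity_det_eq_plethysmCoeffOfPartition_of_card_parts_le_two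
      (m := m) (k := m * m) le_rfl lam' h2 hcardm'
    rw [← plethysmCoeff_toMatIdx_eq_plethysmCoeffOfPartition le_rfl lam' hcardm'] at hfree
    have hfree' : orbitMultiplicity ℂ (detFormLex ℂ m) m (partitionWeightLex m lam') =
        plethysmCoeff ℂ (MatIdx m) m (partitionWeightLex m lam') := hfree
    omega
  exact ⟨d, lam', hcardm', hcardn', hKL, hbody, hrows, hocc1', heq',
    fun hfull => os_lt_of_full_of_equation _ _ hfull heq'⟩

/-- **Every valuative flip contains an outer padded-permanent highest-weight vector.**  If at
`(n, m)` an admissible centre `(U, r)` flips at `λ ⊢ m·δ` (`≤ m²` parts) — the body of the route decl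
`ValuativeGCT.ValuativeFlip` verbatim, `dim T_U(λ) < mult_{λ*} ℂ[Δ_m(X₀₀^{m-n} per_n)]` — then, since
`K_m(λ*) ≤ dim T_U(λ)` (the proved crux `ValuativeBound`), `K_m(λ*) < mult_{λ*} ℂ[Δ_m(pp)]`, and some
highest-weight vector OF WEIGHT `λ*` is an equation of `Δ_m(det_m)` not vanishing on `GL · pp`
(`os_exists_outer_hwv_of_lt`).  So the outer highest-weight vectors of this axis are NECESSARY objects of
every witness of the crux; `lto_exists_partition` says they EXIST at every position of the low tail. [new] -/
theorem lto_exists_outer_hwv_of_flipAt {n m : ℕ} [NeZero m] (U : Submodule ℂ (MatIdx m → ℂ)) (r δ : ℕ)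
    (lam : Nat.Partition (m * δ))
    (hU : ∀ u ∈ U, (Matrix.of fun a b : Fin m => u (toLex (a, b))).rank ≤ r)
    (hlam : lam.parts.card ≤ m * m)
    (hflip : (let χ : Weight (MatIdx m) := (Weight.dualOfPartition (m * m) lam).toMatIdx; let T : Submodule ℂ (MvPolynomial (MatIdx m × MatIdx m) ℂ) := MvPolynomial.homogeneousSubmodule (MatIdx m × MatIdx m) ℂ (m * δ) ⊓ ((MvPolynomial.vanishingIdeal ℂ {p : MatIdx m × MatIdx m → ℂ | ∀ j : MatIdx m, (fun i => p (j, i)) ∈ U}) ^ (δ * (m - r))).restrictScalars ℂ ⊓ (⨅ (M : Matrix (MatIdx m) (MatIdx m) ℂ) (_ : linSubst (MatIdx m) ℂ M (detFormLex ℂ m) = detFormLex ℂ m), LinearMap.ker ((MvPolynomial.aeval (R := ℂ) fun p : MatIdx m × MatIdx m => ∑ l : MatIdx m, M l p.2 • MvPolynomial.X (p.1, l)).toLinearMap - LinearMap.id (R := ℂ) (M := MvPolynomial (MatIdx m × MatIdx m) ℂ))) ⊓ (⨅ (g : Matrix.GeneralLinearGroup (MatIdx m) ℂ) (_ : IsUpperTriangular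 g), LinearMap.ker ((MvPolynomial.aeval (R := ℂ) fun p : MatIdx m × MatIdx m => ∑ l : MatIdx m, ((g⁻¹ : Matrix.GeneralLinearGroup (MatIdx m) ℂ) : Matrix (MatIdx m) (MatIdx m) ℂ) p.1 l • MvPolynomial.X (l, p.2)).toLinearMap - weightChar χ g • LinearMap.id (R := ℂ) (M := MvPolynomial (MatIdx m × MatIdx m) ℂ))); Module.finrank ℂ ↥T < orbitMultiplicity ℂ (paddedPerFormLex ℂ n m) m χ)) :
    ∃ F : MvPolynomial (DegIdx (MatIdx m) m) ℂ,
      F ∈ highestWeightSpace (coordRep (MatIdx m) ℂ m) (partitionWeightLex m lam) ∧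
      F ∈ orbitVanishingIdeal (detFormLex ℂ m) m ∧ F ∉ orbitVanishingIdeal (paddedPerFormLex ℂ n m) m := by
  have hVB := Summit.ValiantsHypothesis.ValiantsHypothesis.Theorems.ValuativeBound.ValuativeBound_proof
    m U r hU δ lam hlam
  have hlt : orbitMultiplicity ℂ (detFormLex ℂ m) m (partitionWeightLex m lam) <
      orbitMultiplicity ℂ (paddedPerFormLex ℂ n m) m (partitionWeightLex m lam) :=
    lt_of_le_of_lt hVB hflip
  exact os_exists_outer_hwv_of_lt (NeZero.ne m) _ _ hlt

end LowTail

end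

end Summit.ValiantsHypothesis.ValiantsHypothesis.Theorems.ValuativeFlip
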